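import Summits.RiemannHypothesis.RiemannHypothesis.Theorems.SoninCertBKappa
import Summits.RiemannHypothesis.RiemannHypothesis.Theorems.SemilocalSoninNearVector
import HarnessLib

/-!
# Sonin-space certificate at `b = 107/200`, P4-B: `B = Re ⟨η | ϑ(T₂ k_G) η⟩` as a finite sum of exponential moments of `κ`

Cell `rh-explicit`, seat cc-s2-3, Phase 2 (lead R7-12/R7-12a).  With `κ = ev kapLit` on `[0, 2b]`, `L = log 2`,
`c(s) = Re ⟨η | ϑ(e^s) η⟩` (even in `s`, `= cfun s` on `[0, 2b + L]`, file P4-A) and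
`T₂ k = (3/2)k − e^{−L/2}(k(· − L) + k(· + L))`:
`B = ∫ T₂k_G · c = ∫_0^{2b} κ(u) (3 c(u) − 2e^{−L/2}(c(u + L) + c(|u − L|))) du`
(translation invariance, evenness of `k_G` and `c`), and inserting the exponential sum `cfun`:
`B = Σ_k (2 r_k P_k(8)) Comb(−k−½) + Σ_{k,n} (−2 r_k (P_k)_n) Comb(n−k−½)` with, for odd `q` and `m = (q+1)/2`,
`Comb(q/2) = (3 − 2^m) J0(q) − 2^m JL(−q) − 2^{1−m} JR(q)`, `J0/JL/JR(q) = ∫ κ(u) e^{qu/2} du` over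
`[0, 2b] / [0, L] / [L, 2b]` — exactly the quantities the kernel file `SoninCertBKernel` encloses (`combI`, `bsumI`).
Main theorem: `re_soninTraceForm_eq_Breal` (the real-side objects `cre`, `J0R`, `JLR`, `JRR`, `combR`, `Bform`, `Breal`,
`phiq` are defined in P4-A).  Proof-only file.  No facts, no axioms; nothing about `ζ`.
-/

set_option linter.dupNamespace false  -- the mandated namespace repeats `RiemannHypothesis`

noncomputable section

open MeasureTheory Complex Set Finset
open scoped Real ComplexConjugate
open Summit.RiemannHypothesis.RiemannHypothesis.Theorems.SemilocalPolyWitness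
open Summit.RiemannHypothesis.RiemannHypothesis.Theorems.MotivicDoor
open Literature.NumberTheory.ConnesConsani2021 Literature.NumberTheory.LFunctions

namespace Summit.RiemannHypothesis.RiemannHypothesis.SoninCert

/-! ## Real-side closed forms (defined in P4-A) -/

/-- `cfun s = Bform (e^{q s/2})_q`. [folklore] -/
theorem cfun_eq_Bform (s : ℝ) : cfun s = Bform fun q => expq q s := rfl

/-- Additivity of `Bform`. [folklore] -/
theorem Bform_add (F G : ℤ → ℝ) : Bform (fun q => F q + G q) = Bform F + Bform G := by
  rw [Bform, Bform, Bform, ← Finset.sum_add_distrib]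
  refine Finset.sum_congr rfl fun k _ => ?_
  simp only [mul_add, Finset.sum_add_distrib]
  ring

/-- Homogeneity of `Bform`. [folklore] -/
theorem Bform_mul (c : ℝ) (F : ℤ → ℝ) : Bform (fun q => c * F q) = c * Bform F := by
  rw [Bform, Bform, Finset.mul_sum]
  refine Finset.sum_congr rfl fun k _ => ?_
  rw [mul_add, Finset.mul_sum]
  congr 1
  · ring
  · exact Finset.sum_congr rfl fun n _ => by ring

/-- Subtraction under `Bform`. [folklore] -/
theorem Bform_sub (F G : ℤ → ℝ) : Bform (fun q => F q - G q) = Bform F - Bform G := by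
  have h := Bform_add (fun q => F q - G q) G
  simp only [sub_add_cancel] at h
  linarith

/-- `Bform` commutes with `∫ g(u) · du` over an interval (continuous data). [folklore] -/
theorem intervalIntegral_mul_Bform {g : ℝ → ℝ} (hg : Continuous g) {F : ℤ → ℝ → ℝ} (hF : ∀ q, Continuous (F q))
    (a w : ℝ) : ∫ u in a..w, g u * Bform (fun q => F q u) = Bform fun q => ∫ u in a..w, g u * F q u := by
  simp only [Bform, Finset.mul_sum, mul_add]
  have hc : ∀ (c : ℝ) (q : ℤ), Continuous (fun u => g u * (c * F q u)) := fun c q =>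
    hg.mul (continuous_const.mul (hF q))
  have hi : ∀ (c : ℝ) (q : ℤ), IntervalIntegrable (fun u => g u * (c * F q u)) volume a w := fun c q =>
    (hc c q).intervalIntegrable _ _
  have hs : ∀ k : ℕ, IntervalIntegrable (fun u => ∑ n ∈ range 75,
      g u * (((-2 * rL.getD k 0 * (pkList k).getD n 0 : ℚ) : ℝ) * F (2 * ((n : ℤ) - k) - 1) u)) volume a w :=
    fun k => (continuous_finsetSum _ fun n _ => hc _ _).intervalIntegrable _ _
  rw [intervalIntegral.integral_finsetSum]
  · refine Finset.sum_congr rfl fun k _ => ?_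
    rw [intervalIntegral.integral_add (hi _ _) (hs k), intervalIntegral.integral_finsetSum]
    · congr 1
      · rw [← intervalIntegral.integral_const_mul]
        exact intervalIntegral.integral_congr fun u _ => by ring
      · refine Finset.sum_congr rfl fun n _ => ?_
        rw [← intervalIntegral.integral_const_mul]
        exact intervalIntegral.integral_congr fun u _ => by ring
    · exact fun n _ => hi _ _
  · intro k _
    exact (hi _ _).add (hs k)

/-! ## `c(τ)`: evenness, boundedness, closed form on `[0, 2b + log 2]` -/

/-- `c` is even. [folklore] -/
theorem cre_neg (τ : ℝ) : cre (-τ) = cre τ := re_scalingCoeff_eta_neg τ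

/-- `|c| ≤ ‖η‖²`. [folklore] -/
theorem abs_cre_le (τ : ℝ) : |cre τ| ≤ ‖eta‖ ^ 2 := abs_re_scalingCoeff_eta_le τ

/-- `c` is continuous. [folklore] -/
theorem continuous_cre : Continuous cre := continuous_re_scalingCoeff_eta

/-- `bQ < log 2` (`0.535 < 0.6931…`). [folklore] -/
theorem bQ_lt_log_two : (bQ : ℝ) < Real.log 2 := by
  have := Real.log_two_gt_d9; rw [bQ]; push_cast; linarith

/-- `e^s < 8` for `s ≤ 2b + log 2`. [folklore] -/
theorem exp_lt_eight {s : ℝ} (hs : s ≤ 2 * bQ + Real.log 2) : Real.exp s < 8 := by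
  have h1 : s < 3 * Real.log 2 := by linarith [bQ_lt_log_two]
  have h2 : Real.exp (3 * Real.log 2) = 8 := by
    rw [show (3 : ℝ) * Real.log 2 = ((3 : ℕ) : ℝ) * Real.log 2 by norm_num, Real.exp_nat_mul,
      Real.exp_log (by norm_num)]; norm_num
  rw [← h2]; exact Real.exp_strictMono h1

/-- `c = cfun` on `[0, 2b + log 2]`. [folklore] -/
theorem cre_eq_cfun {s : ℝ} (hs0 : 0 ≤ s) (hs : s ≤ 2 * bQ + Real.log 2) : cre s = cfun s :=
  re_scalingCoeff_eta hs0 (exp_lt_eight hs)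

/-! ## Step 1: `B = ∫ (T₂ k_G)(τ) c(τ) dτ` as a real integral -/

/-- The real twisted kernel `(T₂ k_G)(τ)`. [folklore] -/
theorem twistKernel_kapFun (τ : ℝ) :
    twistKernel 2 (fun t => ((kapFun t : ℝ) : ℂ)) τ
      = (((3 / 2) * kapFun τ - Real.exp (-(Real.log 2 / 2)) * (kapFun (τ - Real.log 2) + kapFun (τ + Real.log 2)) : ℝ) : ℂ) := by
  rw [twistKernel]; push_cast; ring

/-- `k_G` is integrable. [folklore] -/
theorem integrable_kapFun_complex : Integrable fun t => ((kapFun t : ℝ) : ℂ) :=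
  SemilocalMarkov.integrable_of_norm_le_of_eq_zero (C := (LQ.absBound kapLit (2 * bQ) : ℝ)) (R := 2 * bQ)
    (Complex.continuous_ofReal.measurable.comp measurable_kapFun).aestronglyMeasurable
    (fun t => by rw [Complex.norm_real, Real.norm_eq_abs]; exact abs_kapFun_le t)
    (fun t ht => by rw [kapFun_eq_zero ht, Complex.ofReal_zero])

/-- **`B` as a real integral**: `Re ⟨η | ϑ(T₂ k_G) η⟩ = ∫ ((3/2)κ(τ) − e^{−L/2}(κ(τ−L) + κ(τ+L))) c(τ) dτ`. [folklore] -/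
theorem re_soninTraceForm_eq_integral :
    (soninTraceForm (twistKernel 2 (weilConv (polyWitness gL bQ) (weilReflect (polyWitness gL bQ))))
        (eta : ℝ → ℂ)).re
      = ∫ τ, ((3 / 2) * kapFun τ - Real.exp (-(Real.log 2 / 2)) * (kapFun (τ - Real.log 2) + kapFun (τ + Real.log 2)))
          * cre τ := by
  rw [weilConv_G_eq, soninTraceForm]
  have hint := integrable_mul_scalingCoeff
    (integrable_twistKernel 2 integrable_kapFun_complex) eta eta
  rw [← RCLike.re_to_complex, ← integral_re hint]
  refine integral_congr_ae (Filter.Eventually.of_forall fun τ => ?_)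
  simp only [twistKernel_kapFun, RCLike.re_to_complex, Complex.re_ofReal_mul, cre]

/-! ## Step 2: folding onto `[0, 2b]` -/

/-- `τ ↦ κ(τ + c)·h(τ)` is integrable for bounded continuous `h`. [folklore] -/
theorem integrable_kapFun_shift_mul {h : ℝ → ℝ} (hc : Continuous h) {M : ℝ} (hM : ∀ τ, |h τ| ≤ M) (c : ℝ) :
    Integrable fun τ => kapFun (τ + c) * h τ := by
  refine SemilocalMarkov.integrable_of_norm_le_of_eq_zero (C := (LQ.absBound kapLit (2 * bQ) : ℝ) * M)
    (R := 2 * bQ + |c|) (((measurable_kapFun.comp (measurable_id.add_const c)).mul hc.measurable).aestronglyMeasurable)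
    (fun τ => ?_) (fun τ hτ => ?_)
  · rw [norm_mul, Real.norm_eq_abs, Real.norm_eq_abs]
    exact mul_le_mul (abs_kapFun_le _) (hM τ) (abs_nonneg _) (by exact_mod_cast LQ.absBound_nonneg kapLit (by rw [bQ]; norm_num))
  · rw [kapFun_eq_zero, zero_mul]
    calc 2 * (bQ : ℝ) < |τ| - |c| := by linarith
      _ ≤ |τ + c| := by
          have := abs_add_le (τ + c) (-c)
          rw [add_neg_cancel_right, abs_neg] at this
          linarith

/-- **Folding lemma**: `∫ κ(|u|)1_{|u|≤2b} h(u) du = ∫_0^{2b} κ(u)(h(u) + h(−u)) du` for continuous `h`. [folklore] -/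
theorem integral_kapFun_mul (h : ℝ → ℝ) (hc : Continuous h) :
    ∫ u, kapFun u * h u = ∫ u in (0 : ℝ)..(2 * bQ), LQ.ev kapLit u * (h u + h (-u)) := by
  have hb : (0 : ℝ) ≤ 2 * bQ := by rw [bQ]; norm_num
  rw [← setIntegral_eq_integral_of_forall_compl_eq_zero (s := Icc (-(2 * (bQ : ℝ))) (2 * bQ)) (fun u hu => by
    rw [kapFun_eq_zero (SemilocalMarkov.lt_abs_of_not_mem_Icc hu), zero_mul])]
  rw [setIntegral_congr_fun measurableSet_Icc (fun u hu => by simp only [kapFun_of_abs_le (abs_le.2 hu)] :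
      EqOn (fun u => kapFun u * h u) (fun u => LQ.ev kapLit |u| * h u) (Icc (-(2 * (bQ : ℝ))) (2 * bQ))),
    integral_Icc_eq_integral_Ioc, ← intervalIntegral.integral_of_le (by linarith)]
  have hf : Continuous fun u => LQ.ev kapLit |u| * h u := ((LQ.continuous_ev _).comp continuous_abs).mul hc
  rw [← intervalIntegral.integral_add_adjacent_intervals (b := 0) (hf.intervalIntegrable _ _) (hf.intervalIntegrable _ _)]
  have hneg : ∫ u in (-(2 * (bQ : ℝ)))..0, LQ.ev kapLit |u| * h u = ∫ u in (0 : ℝ)..(2 * bQ), LQ.ev kapLit |u| * h (-u) := by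
    rw [← neg_zero, ← intervalIntegral.integral_comp_neg (fun u => LQ.ev kapLit |u| * h u), neg_zero]
    simp only [abs_neg]
  have hf' : Continuous fun u => LQ.ev kapLit |u| * h (-u) :=
    ((LQ.continuous_ev _).comp continuous_abs).mul (hc.comp continuous_neg)
  rw [hneg, ← intervalIntegral.integral_add (hf'.intervalIntegrable _ _) (hf.intervalIntegrable _ _)]
  refine intervalIntegral.integral_congr fun u hu => ?_
  rw [uIcc_of_le hb] at hu
  rw [abs_of_nonneg hu.1]
  ring

/-- **`B` folded onto `[0, 2b]`**:
`B = ∫_0^{2b} κ(u)(3c(u) − 2e^{−L/2}(c(u+L) + c(|u−L|))) du`. [folklore] -/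
theorem re_soninTraceForm_eq_fold :
    (soninTraceForm (twistKernel 2 (weilConv (polyWitness gL bQ) (weilReflect (polyWitness gL bQ))))
        (eta : ℝ → ℂ)).re
      = ∫ u in (0 : ℝ)..(2 * bQ), LQ.ev kapLit u *
          (3 * cre u - 2 * Real.exp (-(Real.log 2 / 2)) * (cre (u + Real.log 2) + cre |u - Real.log 2|)) := by
  have hM : ∀ τ, |cre τ| ≤ ‖eta‖ ^ 2 := abs_cre_le
  have i0 : Integrable fun τ => kapFun τ * cre τ := by
    simpa using integrable_kapFun_shift_mul continuous_cre hM 0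
  have i1 : Integrable fun τ => kapFun (τ - Real.log 2) * cre τ := by
    simpa [sub_eq_add_neg] using integrable_kapFun_shift_mul continuous_cre hM (-Real.log 2)
  have i2 : Integrable fun τ => kapFun (τ + Real.log 2) * cre τ := integrable_kapFun_shift_mul continuous_cre hM (Real.log 2)
  rw [re_soninTraceForm_eq_integral]
  have e : ∀ τ, ((3 / 2) * kapFun τ - Real.exp (-(Real.log 2 / 2)) * (kapFun (τ - Real.log 2) + kapFun (τ + Real.log 2))) * cre τ
      = (3 / 2) * (kapFun τ * cre τ) - Real.exp (-(Real.log 2 / 2)) * (kapFun (τ - Real.log 2) * cre τ + kapFun (τ + Real.log 2) * cre τ) := fun τ => by ring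
  simp_rw [e]
  have i12 : Integrable fun τ => kapFun (τ - Real.log 2) * cre τ + kapFun (τ + Real.log 2) * cre τ := i1.add i2
  rw [integral_sub (i0.const_mul _) (i12.const_mul _), integral_const_mul, integral_const_mul,
    integral_add i1 i2]
  -- shift the two translated kernels back
  have s1 : ∫ τ, kapFun (τ - Real.log 2) * cre τ = ∫ u, kapFun u * cre (u + Real.log 2) := by
    rw [← integral_add_right_eq_self (fun τ => kapFun (τ - Real.log 2) * cre τ) (Real.log 2)]
    simp only [add_sub_cancel_right]
  have s2 : ∫ τ, kapFun (τ + Real.log 2) * cre τ = ∫ u, kapFun u * cre (u - Real.log 2) := by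
    rw [← integral_sub_right_eq_self (fun τ => kapFun (τ + Real.log 2) * cre τ) (Real.log 2)]
    simp only [sub_add_cancel]
  rw [s1, s2, integral_kapFun_mul (fun u => cre u) continuous_cre,
    integral_kapFun_mul (fun u => cre (u + Real.log 2)) (continuous_cre.comp (continuous_id.add continuous_const)),
    integral_kapFun_mul (fun u => cre (u - Real.log 2)) (continuous_cre.comp (continuous_id.sub continuous_const))]
  have hc : Continuous fun u => LQ.ev kapLit u := LQ.continuous_ev _
  have hI : ∀ f : ℝ → ℝ, Continuous f → IntervalIntegrable (fun u => LQ.ev kapLit u * f u) volume 0 (2 * bQ) :=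
    fun f hf => (hc.mul hf).intervalIntegrable _ _
  have c1 : Continuous fun u => cre u + cre (-u) := continuous_cre.add (continuous_cre.comp continuous_neg)
  have c2 : Continuous fun u => cre (u + Real.log 2) + cre (-u + Real.log 2) :=
    (continuous_cre.comp (continuous_id.add continuous_const)).add
      (continuous_cre.comp ((continuous_neg).add continuous_const))
  have c3 : Continuous fun u => cre (u - Real.log 2) + cre (-u - Real.log 2) :=
    (continuous_cre.comp (continuous_id.sub continuous_const)).add
      (continuous_cre.comp ((continuous_neg).sub continuous_const))
  rw [← intervalIntegral.integral_add (hI _ c2) (hI _ c3), ← intervalIntegral.integral_const_mul,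
    ← intervalIntegral.integral_const_mul, ← intervalIntegral.integral_sub]
  · refine intervalIntegral.integral_congr fun u _ => ?_
    have e1 : cre (-u) = cre u := cre_neg u
    have e2 : cre (-u + Real.log 2) = cre |u - Real.log 2| := by
      rcases le_or_gt (Real.log 2) u with h | h
      · rw [abs_of_nonneg (by linarith), ← cre_neg (-u + Real.log 2)]; ring_nf
      · rw [abs_of_neg (by linarith)]; ring_nf
    have e3 : cre (u - Real.log 2) = cre |u - Real.log 2| := by
      rcases le_or_gt (Real.log 2) u with h | h
      · rw [abs_of_nonneg (by linarith)]
      · rw [abs_of_neg (by linarith), ← cre_neg (u - Real.log 2)]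
    have e4 : cre (-u - Real.log 2) = cre (u + Real.log 2) := by
      rw [← cre_neg (u + Real.log 2)]; ring_nf
    simp only [e1, e2, e3, e4]
    ring
  · exact ((hI _ c1).const_mul _)
  · exact (((hI _ c2).add (hI _ c3)).const_mul _)

/-! ## Step 3: inserting the exponential sum -/

/-- `expq q` is continuous. [folklore] -/
theorem continuous_expq (q : ℤ) : Continuous (expq q) := by
  unfold expq; fun_prop

/-- `phiq q` is continuous. [folklore] -/
theorem continuous_phiq (q : ℤ) : Continuous (phiq q) := by
  unfold phiq
  have h1 := continuous_expq q
  exact (continuous_const.mul h1).sub (continuous_const.mul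
    ((h1.comp (continuous_id.add continuous_const)).add (h1.comp ((continuous_id.sub continuous_const).abs))))

/-- On `[0, 2b]` the integrand of `re_soninTraceForm_eq_fold` is `Bform (Φ_q(u))_q`. [folklore] -/
theorem bracket_eq_Bform {u : ℝ} (hu : u ∈ Icc (0 : ℝ) (2 * bQ)) :
    3 * cre u - 2 * Real.exp (-(Real.log 2 / 2)) * (cre (u + Real.log 2) + cre |u - Real.log 2|)
      = Bform fun q => phiq q u := by
  have hL : 0 < Real.log 2 := Real.log_pos (by norm_num)
  have h1 : cre u = cfun u := cre_eq_cfun hu.1 (by linarith [hu.2])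
  have h2 : cre (u + Real.log 2) = cfun (u + Real.log 2) := cre_eq_cfun (by linarith [hu.1]) (by linarith [hu.2])
  have h3 : cre |u - Real.log 2| = cfun |u - Real.log 2| :=
    cre_eq_cfun (abs_nonneg _) ((abs_sub _ _).trans (by
      rw [abs_of_nonneg hu.1, abs_of_pos hL]; linarith [hu.2, hu.1]))
  rw [h1, h2, h3, cfun_eq_Bform, cfun_eq_Bform, cfun_eq_Bform, ← Bform_add, ← Bform_mul, ← Bform_mul, ← Bform_sub]
  rfl

/-- `e^{n log 2} = 2^n` for an integer `n`. [folklore] -/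
theorem exp_int_mul_log_two (n : ℤ) : Real.exp ((n : ℝ) * Real.log 2) = (2 : ℝ) ^ n := by
  rw [← Real.rpow_intCast, Real.rpow_def_of_pos (by norm_num : (0 : ℝ) < 2), mul_comm]

/-- For odd `q`, `m = (q+1)/2`: `2e^{−L/2}e^{qL/2} = 2^m` and `2e^{−L/2}e^{−qL/2} = 2^{1−m}`. [folklore] -/
theorem twist_constants {q : ℤ} (hq : q % 2 = 1) :
    2 * Real.exp (-(Real.log 2 / 2)) * Real.exp ((q : ℝ) * Real.log 2 / 2) = ((2 ^ ((q + 1) / 2) : ℚ) : ℝ)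
    ∧ 2 * Real.exp (-(Real.log 2 / 2)) * Real.exp ((-q : ℤ) * Real.log 2 / 2) = ((2 ^ (1 - (q + 1) / 2) : ℚ) : ℝ) := by
  set m : ℤ := (q + 1) / 2 with hm
  have hqm : (q : ℝ) = 2 * m - 1 := by
    have : q = 2 * m - 1 := by omega
    exact_mod_cast this
  have two : Real.exp (Real.log 2) = 2 := Real.exp_log (by norm_num)
  constructor
  · have e : ((2 ^ ((q + 1) / 2) : ℚ) : ℝ) = Real.exp ((m : ℝ) * Real.log 2) := by
      rw [exp_int_mul_log_two]; push_cast; rw [← hm]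
    rw [e, show (m : ℝ) * Real.log 2 = Real.log 2 + -(Real.log 2 / 2) + (q : ℝ) * Real.log 2 / 2 by rw [hqm]; ring,
      Real.exp_add, Real.exp_add, two]
  · have e : ((2 ^ (1 - (q + 1) / 2) : ℚ) : ℝ) = Real.exp (((1 - m : ℤ) : ℝ) * Real.log 2) := by
      rw [exp_int_mul_log_two]; push_cast; rw [← hm]
    rw [e, show ((1 - m : ℤ) : ℝ) * Real.log 2 = Real.log 2 + -(Real.log 2 / 2) + ((-q : ℤ) : ℝ) * Real.log 2 / 2 by
      push_cast; rw [hqm]; ring, Real.exp_add, Real.exp_add, two]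

/-- `Bform` only sees odd arguments. [folklore] -/
theorem Bform_congr {F G : ℤ → ℝ} (h : ∀ q : ℤ, q % 2 = 1 → F q = G q) : Bform F = Bform G := by
  unfold Bform
  refine Finset.sum_congr rfl fun k _ => ?_
  rw [h _ (by omega)]
  congr 1
  exact Finset.sum_congr rfl fun n _ => by rw [h _ (by omega)]

/-- **The `u`-integral of `Φ_q` against `κ` is `Comb(q/2)`** (`q` odd). [folklore] -/
theorem intervalIntegral_kap_phiq {q : ℤ} (hq : q % 2 = 1) :
    ∫ u in (0 : ℝ)..(2 * bQ), LQ.ev kapLit u * phiq q u = combR q := by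
  have hL0 : 0 < Real.log 2 := Real.log_pos (by norm_num)
  have hLb : Real.log 2 ≤ 2 * bQ := by rw [bQ]; have := Real.log_two_lt_d9; push_cast; linarith
  have hc : Continuous fun u => LQ.ev kapLit u := LQ.continuous_ev _
  have hI : ∀ (f : ℝ → ℝ) (a w : ℝ), Continuous f → IntervalIntegrable (fun u => LQ.ev kapLit u * f u) volume a w :=
    fun f a w hf => (hc.mul hf).intervalIntegrable _ _
  have he := continuous_expq q
  have hca : Continuous fun u => expq q |u - Real.log 2| := he.comp ((continuous_id.sub continuous_const).abs)
  have hcb : Continuous fun u => expq q (u + Real.log 2) := he.comp (continuous_id.add continuous_const)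
  -- the shifted exponential
  have hshift : ∀ u, expq q (u + Real.log 2) = Real.exp ((q : ℝ) * Real.log 2 / 2) * expq q u := fun u => by
    rw [expq, expq, ← Real.exp_add]; congr 1; ring
  -- split the `|u - L|` integral at `L`
  have hA : ∫ u in (0 : ℝ)..(2 * bQ), LQ.ev kapLit u * expq q |u - Real.log 2|
      = Real.exp ((q : ℝ) * Real.log 2 / 2) * JLR (-q) + Real.exp ((-q : ℤ) * Real.log 2 / 2) * JRR q := by
    rw [← intervalIntegral.integral_add_adjacent_intervals (b := Real.log 2)
      (hI (fun u => expq q |u - Real.log 2|) 0 (Real.log 2) hca)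
      (hI (fun u => expq q |u - Real.log 2|) (Real.log 2) (2 * bQ) hca), JLR, JRR,
      ← intervalIntegral.integral_const_mul, ← intervalIntegral.integral_const_mul]
    congr 1
    · refine intervalIntegral.integral_congr fun u hu => ?_
      rw [uIcc_of_le hL0.le] at hu
      have h' : u - Real.log 2 ≤ 0 := by linarith [hu.2]
      simp only [abs_of_nonpos h', neg_sub, expq]
      rw [show (q : ℝ) * (Real.log 2 - u) / 2 = (q : ℝ) * Real.log 2 / 2 + ((-q : ℤ) : ℝ) * u / 2 by push_cast; ring,
        Real.exp_add]
      ring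
    · refine intervalIntegral.integral_congr fun u hu => ?_
      rw [uIcc_of_le hLb] at hu
      have h' : 0 ≤ u - Real.log 2 := by linarith [hu.1]
      simp only [abs_of_nonneg h', expq]
      rw [show (q : ℝ) * (u - Real.log 2) / 2 = ((-q : ℤ) : ℝ) * Real.log 2 / 2 + (q : ℝ) * u / 2 by push_cast; ring,
        Real.exp_add]
      ring
  have hB : ∫ u in (0 : ℝ)..(2 * bQ), LQ.ev kapLit u * expq q (u + Real.log 2)
      = Real.exp ((q : ℝ) * Real.log 2 / 2) * J0R q := by
    rw [J0R, ← intervalIntegral.integral_const_mul]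
    exact intervalIntegral.integral_congr fun u _ => by simp only [hshift]; ring
  have e : ∀ u, LQ.ev kapLit u * phiq q u = 3 * (LQ.ev kapLit u * expq q u)
      - 2 * Real.exp (-(Real.log 2 / 2)) * (LQ.ev kapLit u * expq q (u + Real.log 2))
      - 2 * Real.exp (-(Real.log 2 / 2)) * (LQ.ev kapLit u * expq q |u - Real.log 2|) := fun u => by rw [phiq]; ring
  simp_rw [e]
  rw [intervalIntegral.integral_sub, intervalIntegral.integral_sub, intervalIntegral.integral_const_mul,
    intervalIntegral.integral_const_mul, intervalIntegral.integral_const_mul, hA, hB, combR]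
  · obtain ⟨t1, t2⟩ := twist_constants hq
    rw [← J0R]
    have : ((3 - 2 ^ ((q + 1) / 2) : ℚ) : ℝ) = 3 - ((2 ^ ((q + 1) / 2) : ℚ) : ℝ) := by push_cast; ring
    rw [this, ← t1, ← t2]; ring
  · exact (hI (fun u => expq q u) _ _ he).const_mul _
  · exact (hI (fun u => expq q (u + Real.log 2)) _ _ hcb).const_mul _
  · exact ((hI (fun u => expq q u) _ _ he).const_mul _).sub ((hI (fun u => expq q (u + Real.log 2)) _ _ hcb).const_mul _)
  · exact (hI (fun u => expq q |u - Real.log 2|) _ _ hca).const_mul _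

/-- **`B` is the finite exponential-moment sum `Breal`** (the quantity enclosed by `SoninCertBKernel.bsumI`). [folklore] -/
theorem re_soninTraceForm_eq_Breal :
    (soninTraceForm (twistKernel 2 (weilConv (polyWitness gL bQ) (weilReflect (polyWitness gL bQ))))
        (eta : ℝ → ℂ)).re = Breal := by
  rw [re_soninTraceForm_eq_fold]
  have hb : (0 : ℝ) ≤ 2 * bQ := by rw [bQ]; norm_num
  have h1 : ∫ u in (0 : ℝ)..(2 * bQ), LQ.ev kapLit u *
        (3 * cre u - 2 * Real.exp (-(Real.log 2 / 2)) * (cre (u + Real.log 2) + cre |u - Real.log 2|))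
      = ∫ u in (0 : ℝ)..(2 * bQ), LQ.ev kapLit u * Bform (fun q => phiq q u) :=
    intervalIntegral.integral_congr fun u hu => by
      have hu' : u ∈ Icc (0 : ℝ) (2 * bQ) := by rwa [uIcc_of_le hb] at hu
      simp only [bracket_eq_Bform hu']
  rw [h1, intervalIntegral_mul_Bform (LQ.continuous_ev _) continuous_phiq, Breal]
  exact Bform_congr fun q hq => intervalIntegral_kap_phiq hq

end Summit.RiemannHypothesis.RiemannHypothesis.SoninCert
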